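import Summits.QuantumFields.YangMills.Theorems.ScalingWindowSplitSelfNormalisedSkewnessWitnessDefs
import Summits.QuantumFields.YangMills.Theorems.ScalingWindowSplitSelfNormalisedSkewnessStubRangeProjectionKernel
import Literature.Probability.LatticeModels.TorusGreenHessianDecay
import HarnessLib

/-!
# Crux `SelfNormalisedSkewness` (stmt-QuantumFields-18944, line `Sketch`): stub `stub_frameKernel`

Negation branch (the `U(1)` counter-witness). Let `d = plaqCoboundary S : ℝ^{Edge 4 S} → ℝ^{Plaquette 4 S}`
be the real plaquette coboundary of the four-torus `(ℤ/S)⁴`, `V = im d ⊆ ℝ^{Plaquette 4 S}` the space of exact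
plaquette fields (a subspace of a Euclidean space, with the induced inner product) and `Π_V : ℝ^{Plaquette} → V`
the orthogonal projection INTO the subtype (`Submodule.orthogonalProjectionOnto`). The vectors
`a_p = Π_V e_p` (`e_p = EuclideanSpace.single p 1`) satisfy

* `⟪a_p, v⟫_V = v(p)` for `v ∈ V` (self-adjointness of the projection), hence
* `∑_p ⟪a_p, v⟫_V² = ‖v‖²` (they form a Parseval frame of `V`), and
* their Gram matrix `⟪a_p, a_q⟫_V = ⟪Π e_p, e_q⟫` is the lattice Maxwell kernel `πK(x_p - x_q; μν, ρσ)`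
  computed in `stub_rangeProjectionKernel` (module `…StubRangeProjectionKernel`) in terms of the mixed second
  differences `H_{ij}(n) = G̃(n+eᵢ) - G̃(n+eᵢ-eⱼ) - G̃(n) + G̃(n-eⱼ)` of the zero-mode-free torus Green function
  `G̃ = torusGreen`.

Elementary linear algebra on top of the landed kernel formula; `H` and `πK` enter through defining hypotheses
(no new definitions).
-/

noncomputable section

open scoped BigOperators ENNReal InnerProductSpace
open Literature.MathematicalPhysics.QuantumLattice Literature.MathematicalPhysics.QuantumFieldTheory
open Literature.Probability.LatticeModels (TorusSite torusGreen)

namespace Summit.QuantumFields.YangMills.Theorems.SelfNormalisedSkewness.Negative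

/-- **Self-adjointness of the projection against coordinate vectors**: for a subspace `V` of `ℝ^ι` and
`v ∈ V`, `⟪Π_V e_p, v⟫_V = v(p)`. [folklore] -/
theorem inner_orthogonalProjectionOnto_single_left {ι : Type*} [Fintype ι] [DecidableEq ι]
    (V : Submodule ℝ (EuclideanSpace ℝ ι)) (v : V) (p : ι) :
    ⟪V.orthogonalProjectionOnto (EuclideanSpace.single p (1 : ℝ)), v⟫_ℝ = (v : EuclideanSpace ℝ ι) p := by
  rw [Submodule.inner_orthogonalProjectionOnto_eq_of_mem_right, EuclideanSpace.inner_single_left, map_one,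
    one_mul]

/-- **Parseval identity for the projected coordinate frame**: for a subspace `V` of `ℝ^ι` and `v ∈ V`,
`∑_p ⟪Π_V e_p, v⟫_V² = ‖v‖²`. [folklore] -/
theorem sum_sq_inner_orthogonalProjectionOnto_single {ι : Type*} [Fintype ι] [DecidableEq ι]
    (V : Submodule ℝ (EuclideanSpace ℝ ι)) (v : V) :
    ∑ p, ⟪V.orthogonalProjectionOnto (EuclideanSpace.single p (1 : ℝ)), v⟫_ℝ ^ 2 = ‖v‖ ^ 2 := by
  simp_rw [inner_orthogonalProjectionOnto_single_left]
  rw [Submodule.coe_norm, EuclideanSpace.real_norm_sq_eq]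

/-- **Gram matrix of the projected coordinate frame**: `⟪Π_V e_p, Π_V e_q⟫_V = ⟪Π e_p, e_q⟫` with `Π` the
self-adjoint projection of the ambient space (`Submodule.starProjection`). [folklore] -/
theorem inner_orthogonalProjectionOnto_single_single {ι : Type*} [Fintype ι] [DecidableEq ι]
    (V : Submodule ℝ (EuclideanSpace ℝ ι)) (p q : ι) :
    ⟪V.orthogonalProjectionOnto (EuclideanSpace.single p (1 : ℝ)),
        V.orthogonalProjectionOnto (EuclideanSpace.single q (1 : ℝ))⟫_ℝ =
      ⟪V.starProjection (EuclideanSpace.single p (1 : ℝ)), EuclideanSpace.single q (1 : ℝ)⟫_ℝ := by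
  rw [Submodule.inner_orthogonalProjectionOnto_eq_of_mem_left, Submodule.coe_orthogonalProjectionOnto_apply]

/-- Wave-3 stub: the Parseval frame `a_p = Π_V e_p` of `V = im d` and its Gram kernel. [folklore] -/
theorem stub_frameKernel (S : ℕ) [NeZero S] (H : TorusSite 4 S → Fin 4 → Fin 4 → ℝ)
    (hH : ∀ z i j, H z i j = torusGreen (z + Pi.single i 1) - torusGreen (z + Pi.single i 1 - Pi.single j 1) -
      torusGreen z + torusGreen (z - Pi.single j 1))
    (πK : TorusSite 4 S → {q : Fin 4 × Fin 4 // q.1 < q.2} → {q : Fin 4 × Fin 4 // q.1 < q.2} → ℝ)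
    (hπK : ∀ n α α', πK n α α' = (1 / 2 : ℝ) * (-(H n α.1.1 α'.1.1) * (if α.1.2 = α'.1.2 then 1 else 0)
        + H n α.1.1 α'.1.2 * (if α.1.2 = α'.1.1 then 1 else 0)
        + H n α.1.2 α'.1.1 * (if α.1.1 = α'.1.2 then 1 else 0)
        - H n α.1.2 α'.1.2 * (if α.1.1 = α'.1.1 then 1 else 0))) :
    (∀ v : LinearMap.range (plaqCoboundary S), ∑ p : Plaquette 4 S,
        ⟪(LinearMap.range (plaqCoboundary S)).orthogonalProjectionOnto (EuclideanSpace.single p (1 : ℝ)), v⟫_ℝ ^ 2 =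
          ‖v‖ ^ 2) ∧
    (∀ (v : LinearMap.range (plaqCoboundary S)) (p : Plaquette 4 S),
        ⟪(LinearMap.range (plaqCoboundary S)).orthogonalProjectionOnto (EuclideanSpace.single p (1 : ℝ)), v⟫_ℝ =
          (v : EuclideanSpace ℝ (Plaquette 4 S)) p) ∧
    (∀ p q : Plaquette 4 S,
        ⟪(LinearMap.range (plaqCoboundary S)).orthogonalProjectionOnto (EuclideanSpace.single p (1 : ℝ)),
          (LinearMap.range (plaqCoboundary S)).orthogonalProjectionOnto (EuclideanSpace.single q (1 : ℝ))⟫_ℝ =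
          πK (p.1 - q.1) p.2 q.2) := by
  refine ⟨fun v => sum_sq_inner_orthogonalProjectionOnto_single _ v,
    fun v p => inner_orthogonalProjectionOnto_single_left _ v p, fun p q => ?_⟩
  rw [inner_orthogonalProjectionOnto_single_single,
    stub_rangeProjectionKernel S (plaqCoboundary S) (plaqCoboundary_apply S) p q, hπK, hH, hH, hH, hH]

end Summit.QuantumFields.YangMills.Theorems.SelfNormalisedSkewness.Negative

end
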